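import Mathlib
import HarnessLib
import Literature.Computability.AlgebraicComplexity.PatternExpressions
import Summits.ValiantsHypothesis.ValiantsHypothesis.Theorems.MonotoneRestorationOrbitCompressionQPDiHomSpan
import Summits.ValiantsHypothesis.ValiantsHypothesis.Theorems.MonotoneRestorationMonotoneRestorationQPLinearWidthOrbitSeparation

/-!
# Route MonotoneRestoration, derived node `NonnegRestorationQP` (stmt-16191) / aside `OrbitCompressionQP`
# (stmt-18332) — LOVÁSZ'S THEOREM IN THE ONE-SORTED (SQUARE-SYMMETRIC) CURRENCY: two complex
# edge-weighted DIRECTED graphs with loops agree on all directed looped homomorphism polynomials of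
# patterns on `≤ n` vertices iff they are isomorphic

Helper file (`--supports stmt-ValiantsHypothesis-16191`), def-free.  The compression line of
`OrbitCompressionQP` (= `stub_orbitCompression` of `Cruxes/NonnegRestorationQP/Lines/orbit_cut.lean`) lives,
on the circuit side, in the ONE-SORTED currency: its circuits are symmetric under the DIAGONAL action
`x_ij ↦ x_{σ i, σ j}` of `Sym_n`, and square-symmetric polynomials are `ℂ`-combinations of the directed
looped homomorphism polynomials `dihom_{E,n} = Σ_{h : Fin a → Fin n} Π_{(u,v) ∈ E} x_{h u, h v}`
(`DiHomSpan.mem_span_diHom_of_squareSymmetric`, patterns with `a ≤ min(2·deg, n)` vertices).  This file is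
the one-sorted twin of `Theorems/…LinearWidthOrbitSeparation.lean` (the bipartite / matrix-symmetric case):

* `exists_squareSymmetric_separating` — ORBIT SEPARATION for the diagonal action: if `B ≠ A ∘ (σ × σ)`
  for every `σ`, a square-symmetric polynomial of degree `< 2·n!` takes the value `|Stab A| ≠ 0` at `A`
  and `0` at `B` (Reynolds sum over `Sym_n` of a Lagrange interpolant, `OrbitSeparation.exists_interpolant`);
* `exists_diHom_separating` — hence some `dihom_{E,n}` with `E` a directed multigraph pattern on `≤ n`
  vertices (and `< 4·n!` vertices, `< 2·n!` edges, no isolated vertex) separates `A` from `B`;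
* `forall_eval_diHom_eq_iff_exists_perm` — THE THEOREM: `A, B ∈ ℂ^{n×n}` (complex edge-weighted directed
  graphs with loops on `[n]`) agree on all `dihom_{E,n}`, `E` on `≤ n` vertices, iff `B = A ∘ (σ × σ)` for
  some `σ ∈ Sym_n`; `forall_eval_diHom_eq_iff_exists_perm'` — the same over all directed patterns;
* `eval_eq_of_diHomIndist_of_squareSymmetric` — so every square-symmetric polynomial (in particular every
  gate value of a square-symmetric circuit) is determined by the values of the `dihom_{E,n}`, `E` on `≤ n`
  vertices: the top of the one-sorted width scale in which a correct first half of the compression line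
  ("qp-orbit square-symmetric circuits ⇒ narrow DIRECTED expressions") would be graded.

Honest label: calibration / classical theorem (Lovász 1967 for `hom(·, H)`, here for arbitrary complex
weights, directed, with loops) newly available in the tree; no stub closed; VP ≠ VNP not moved.
[cite: DawarPagoSeppelt2025, Remark p. 17 and §8 p. 45]
-/

-- `Summit.ValiantsHypothesis.ValiantsHypothesis.…` is the tree's mandated namespace (Sub = Summit).
set_option linter.dupNamespace false

noncomputable section

namespace Summit.ValiantsHypothesis.ValiantsHypothesis.Theorems

namespace DiOrbitSeparation

open Literature.Computability.AlgebraicComplexity MvPolynomial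

variable {n : ℕ}

/-- If `B ∘ (σ × σ) = A` then `B = A ∘ (σ⁻¹ × σ⁻¹)`. [folklore] -/
theorem eq_perm_of_comp_eq (A B : Fin n × Fin n → ℂ) (σ : Equiv.Perm (Fin n))
    (h : (B ∘ fun ij : Fin n × Fin n => (σ ij.1, σ ij.2)) = A) :
    B = fun ij : Fin n × Fin n => A (σ⁻¹ ij.1, σ⁻¹ ij.2) := by
  funext ij
  have := congrFun h (σ⁻¹ ij.1, σ⁻¹ ij.2)
  simpa using this

/-- **Orbit separation for the diagonal action.**  If `B ∈ ℂ^{n×n}` is not of the form `A ∘ (σ × σ)`,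
some square-symmetric polynomial of total degree `< 2·n!` takes different values at `A` and `B`.
[folklore] -/
theorem exists_squareSymmetric_separating (A B : Fin n × Fin n → ℂ)
    (hAB : ∀ σ : Equiv.Perm (Fin n), B ≠ fun ij : Fin n × Fin n => A (σ ij.1, σ ij.2)) :
    ∃ q : MvPolynomial (Fin n × Fin n) ℂ,
      (∀ σ : Equiv.Perm (Fin n), rename (fun ij : Fin n × Fin n => (σ ij.1, σ ij.2)) q = q) ∧
      eval A q ≠ eval B q ∧ q.totalDegree < 2 * Nat.factorial n := by
  classical
  let G := Equiv.Perm (Fin n)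
  let act : G → Fin n × Fin n → Fin n × Fin n := fun g ij => (g ij.1, g ij.2)
  let T : Finset (Fin n × Fin n → ℂ) :=
    (Finset.univ.image fun g : G => A ∘ act g) ∪ Finset.univ.image fun g : G => B ∘ act g
  have hAT : A ∈ T := Finset.mem_union_left _ (Finset.mem_image.2 ⟨1, Finset.mem_univ _, by
    funext ij; simp [act, G, Equiv.Perm.one_apply]⟩)
  obtain ⟨p, hpA, hpT, hdeg⟩ :=
    OrbitSeparation.exists_interpolant A (T.erase A) (Finset.notMem_erase A T)
  have hBact : ∀ g : G, B ∘ act g ≠ A := fun g h => hAB _ (eq_perm_of_comp_eq A B g h)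
  refine ⟨∑ g : G, rename (act g) p, fun σ => ?_, ?_, ?_⟩
  · simp only [map_sum, rename_rename]
    refine Fintype.sum_equiv (Equiv.mulLeft (σ : G)) _ _ fun g => ?_
    congr 1
  · have hB : eval B (∑ g : G, rename (act g) p) = 0 := by
      simp only [map_sum, eval_rename]
      refine Finset.sum_eq_zero fun g _ => hpT _ (Finset.mem_erase.2 ⟨hBact g, ?_⟩)
      exact Finset.mem_union_right _ (Finset.mem_image.2 ⟨g, Finset.mem_univ _, rfl⟩)
    have hA : eval A (∑ g : G, rename (act g) p) =
        ((Finset.univ.filter fun g : G => A ∘ act g = A).card : ℂ) := by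
      simp only [map_sum, eval_rename]
      rw [← Finset.sum_filter_add_sum_filter_not Finset.univ (fun g : G => A ∘ act g = A),
        Finset.sum_congr rfl (fun g hg => by rw [(Finset.mem_filter.1 hg).2, hpA]),
        Finset.sum_congr rfl (fun g hg => hpT _ (Finset.mem_erase.2 ⟨(Finset.mem_filter.1 hg).2,
          Finset.mem_union_left _ (Finset.mem_image.2 ⟨g, Finset.mem_univ _, rfl⟩)⟩))]
      simp
    have hpos : 0 < (Finset.univ.filter fun g : G => A ∘ act g = A).card :=
      Finset.card_pos.2 ⟨1, Finset.mem_filter.2 ⟨Finset.mem_univ _, by funext ij; simp [act, G, Equiv.Perm.one_apply]⟩⟩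
    rw [hA, hB]
    exact_mod_cast hpos.ne'
  · have hT : T.card ≤ 2 * Nat.factorial n :=
      calc T.card ≤ (Finset.univ.image fun g : G => A ∘ act g).card +
            (Finset.univ.image fun g : G => B ∘ act g).card := Finset.card_union_le _ _
        _ ≤ Fintype.card G + Fintype.card G :=
            Nat.add_le_add (Finset.card_image_le.trans (Finset.card_univ (α := G)).le)
              (Finset.card_image_le.trans (Finset.card_univ (α := G)).le)
        _ = 2 * Nat.factorial n := by
            simp only [G, Fintype.card_perm, Fintype.card_fin]; ring
    have hT0 : (T.erase A).card < 2 * Nat.factorial n := by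
      rw [Finset.card_erase_of_mem hAT]
      have := Finset.card_pos.2 ⟨A, hAT⟩
      omega
    calc (∑ g : G, rename (act g) p).totalDegree
        ≤ Finset.univ.sup fun g : G => (rename (act g) p).totalDegree := totalDegree_finsetSum _ _
      _ ≤ p.totalDegree := Finset.sup_le fun g _ => totalDegree_rename_le _ _
      _ < 2 * Nat.factorial n := hdeg.trans_lt hT0

/-- **Some directed looped homomorphism polynomial separates non-isomorphic edge-weighted digraphs.**
If `B ≠ A ∘ (σ × σ)` for every `σ`, then `dihom_{E,n}(A) ≠ dihom_{E,n}(B)` for a directed multigraph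
pattern `E` on `a ≤ n` vertices (indeed `a < 4·n!`, `< 2·n!` edges, no isolated vertex).
[cite: DawarPagoSeppelt2025, Remark p. 17] -/
theorem exists_diHom_separating (A B : Fin n × Fin n → ℂ)
    (hAB : ∀ σ : Equiv.Perm (Fin n), B ≠ fun ij : Fin n × Fin n => A (σ ij.1, σ ij.2)) :
    ∃ (a : ℕ) (E : Multiset (Fin a × Fin a)),
      a < 4 * Nat.factorial n ∧ a ≤ n ∧ Multiset.card E < 2 * Nat.factorial n ∧
      (∀ v : Fin a, ∃ e ∈ E, e.1 = v ∨ e.2 = v) ∧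
      eval A (∑ h : Fin a → Fin n,
          (E.map fun e => (X (h e.1, h e.2) : MvPolynomial (Fin n × Fin n) ℂ)).prod) ≠
        eval B (∑ h : Fin a → Fin n,
          (E.map fun e => (X (h e.1, h e.2) : MvPolynomial (Fin n × Fin n) ℂ)).prod) := by
  obtain ⟨q, hq, hsep, hdeg⟩ := exists_squareSymmetric_separating A B hAB
  by_contra h
  push Not at h
  apply hsep
  refine Submodule.span_induction (p := fun r _ => eval A r = eval B r) ?_ (by simp)
    (fun x y _ _ hx hy => by simp [hx, hy]) (fun c x _ hx => by simp [hx])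
    (DiHomSpan.mem_span_diHom_of_squareSymmetric q hq)
  rintro r ⟨a, E, ha, han, hE, hiso, rfl⟩
  exact h a E (by omega) han (by omega) hiso

/-- The diagonal renaming does not change the values of directed homomorphism polynomials (they are
square-symmetric, `DiHomSpan.rename_diHom`). [folklore] -/
theorem eval_diHom_perm (A : Fin n × Fin n → ℂ) (σ : Equiv.Perm (Fin n)) {a : ℕ}
    (E : Multiset (Fin a × Fin a)) :
    eval (fun ij : Fin n × Fin n => A (σ ij.1, σ ij.2))
        (∑ h : Fin a → Fin n, (E.map fun e => (X (h e.1, h e.2) : MvPolynomial (Fin n × Fin n) ℂ)).prod) =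
      eval A (∑ h : Fin a → Fin n,
        (E.map fun e => (X (h e.1, h e.2) : MvPolynomial (Fin n × Fin n) ℂ)).prod) := by
  conv_rhs => rw [← DiHomSpan.rename_diHom E n σ]
  rw [eval_rename]
  rfl

/-- **Lovász's theorem for complex edge-weighted directed graphs with loops** (patterns on `≤ n`
vertices).  `A, B ∈ ℂ^{n×n}` agree on every directed looped homomorphism polynomial `dihom_{E,n}` with
`E` on at most `n` vertices iff `B = A ∘ (σ × σ)` for some `σ ∈ Sym_n`.
[cite: DawarPagoSeppelt2025, Remark p. 17 and §8 p. 45] -/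
theorem forall_eval_diHom_eq_iff_exists_perm (A B : Fin n × Fin n → ℂ) :
    (∀ (a : ℕ) (E : Multiset (Fin a × Fin a)), a ≤ n →
      eval A (∑ h : Fin a → Fin n,
          (E.map fun e => (X (h e.1, h e.2) : MvPolynomial (Fin n × Fin n) ℂ)).prod) =
        eval B (∑ h : Fin a → Fin n,
          (E.map fun e => (X (h e.1, h e.2) : MvPolynomial (Fin n × Fin n) ℂ)).prod)) ↔
    ∃ σ : Equiv.Perm (Fin n), B = fun ij : Fin n × Fin n => A (σ ij.1, σ ij.2) := by
  constructor
  · intro h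
    by_contra hne
    push Not at hne
    obtain ⟨a, E, -, han, -, -, hsep⟩ := exists_diHom_separating A B hne
    exact hsep (h a E han)
  · rintro ⟨σ, rfl⟩ a E -
    exact (eval_diHom_perm A σ E).symm

/-- Threshold-free form: agreement on ALL directed looped homomorphism polynomials is isomorphism.
[cite: DawarPagoSeppelt2025, Remark p. 17 and §8 p. 45] -/
theorem forall_eval_diHom_eq_iff_exists_perm' (A B : Fin n × Fin n → ℂ) :
    (∀ (a : ℕ) (E : Multiset (Fin a × Fin a)),
      eval A (∑ h : Fin a → Fin n,
          (E.map fun e => (X (h e.1, h e.2) : MvPolynomial (Fin n × Fin n) ℂ)).prod) =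
        eval B (∑ h : Fin a → Fin n,
          (E.map fun e => (X (h e.1, h e.2) : MvPolynomial (Fin n × Fin n) ℂ)).prod)) ↔
    ∃ σ : Equiv.Perm (Fin n), B = fun ij : Fin n × Fin n => A (σ ij.1, σ ij.2) := by
  refine ⟨fun h => (forall_eval_diHom_eq_iff_exists_perm A B).1 fun a E _ => h a E, ?_⟩
  rintro ⟨σ, rfl⟩ a E
  exact (eval_diHom_perm A σ E).symm

/-- **Every square-symmetric polynomial is determined by the directed looped homomorphism polynomials of
patterns on `≤ n` vertices** (in particular every gate value of a square-symmetric circuit on the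
`n × n` matrix). [folklore] -/
theorem eval_eq_of_diHomIndist_of_squareSymmetric (F : MvPolynomial (Fin n × Fin n) ℂ)
    (hF : ∀ σ : Equiv.Perm (Fin n), rename (fun ij : Fin n × Fin n => (σ ij.1, σ ij.2)) F = F)
    (A B : Fin n × Fin n → ℂ)
    (hind : ∀ (a : ℕ) (E : Multiset (Fin a × Fin a)), a ≤ n →
      eval A (∑ h : Fin a → Fin n,
          (E.map fun e => (X (h e.1, h e.2) : MvPolynomial (Fin n × Fin n) ℂ)).prod) =
        eval B (∑ h : Fin a → Fin n,
          (E.map fun e => (X (h e.1, h e.2) : MvPolynomial (Fin n × Fin n) ℂ)).prod)) :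
    eval A F = eval B F := by
  obtain ⟨σ, rfl⟩ := (forall_eval_diHom_eq_iff_exists_perm A B).1 hind
  conv_lhs => rw [← hF σ]
  rw [eval_rename]
  rfl

/-- **Matrix-symmetric values need bipartite patterns only up to the square/bipartite gap**: two points
in the same DIAGONAL orbit are in the same `Sym_n × Sym_n` orbit, so agreement on all directed looped
homomorphism polynomials (patterns on `≤ n` vertices) implies agreement on all bipartite ones — the
one-sorted scale refines the two-sorted scale of line `linear-width`. [folklore] -/
theorem eval_homPoly_eq_of_diHomIndist (A B : Fin n × Fin n → ℂ)
    (hind : ∀ (a : ℕ) (E : Multiset (Fin a × Fin a)), a ≤ n →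
      eval A (∑ h : Fin a → Fin n,
          (E.map fun e => (X (h e.1, h e.2) : MvPolynomial (Fin n × Fin n) ℂ)).prod) =
        eval B (∑ h : Fin a → Fin n,
          (E.map fun e => (X (h e.1, h e.2) : MvPolynomial (Fin n × Fin n) ℂ)).prod))
    {a b : ℕ} (E : Multiset (Fin a × Fin b)) :
    eval A (homPoly E n ℂ) = eval B (homPoly E n ℂ) := by
  obtain ⟨σ, rfl⟩ := (forall_eval_diHom_eq_iff_exists_perm A B).1 hind
  exact (OrbitSeparation.eval_homPoly_perm A σ σ E).symm

end DiOrbitSeparation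

end Summit.ValiantsHypothesis.ValiantsHypothesis.Theorems

end
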